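import Mathlib.RingTheory.QuotSMulTop
import Mathlib.Algebra.Homology.HomologicalComplex
import Mathlib.Algebra.Category.ModuleCat.Basic
import HarnessLib

/-!
# The reduction `K• ↦ K•/rK•` of a cochain complex of modules modulo a ring element

Layer `Literature/Algebra/Homology`, namespace `Literature.Algebra.Homology`.  DEFINITIONS + `rfl`-lemmas only (plumbing for the
acyclicity lemma `Algebra/Homology/AcyclicityLemmaRegularSequence` and for reductions of Grothendieck complexes modulo regular
sequences, [MumfordAV1970] §13).

For a commutative ring `R`, `r ∈ R` and a cochain complex `K•` of `R`-modules (`CochainComplex (ModuleCat R) ℤ`):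
* `modSMulComplex r K` — the complex `K•/rK•`, termwise Mathlib's `QuotSMulTop r Kⁱ = Kⁱ ⧸ r • ⊤`, differential
  `QuotSMulTop.map r d`; this is `K• ⊗_R R/(r)` in the spelling under which regular sequences peel off
  (`RingTheory.Sequence.isWeaklyRegular_cons_iff`);
* `modSMulComplexπ r K : K ⟶ modSMulComplex r K` — the quotient morphism;
* `rfl`-lemmas `modSMulComplex_X`, `modSMulComplex_d_mk` (`d̄ [x] = [d x]`), `modSMulComplex_d_hom`, `modSMulComplexπ_f_apply`.

## References
* [PeskineSzpiro1973] C. Peskine, L. Szpiro, *Dimension projective finie et cohomologie locale*, Publ. Math. IHÉS 42 (1973),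
  Lemme (1.8) («lemme d'acyclicité») — complexes reduced modulo a regular element.
* [BrunsHerzog1998] W. Bruns, J. Herzog, *Cohen–Macaulay rings*, rev. ed. (1998), §1.1 (regular sequences, `M/xM`).
* [MumfordAV1970] D. Mumford, *Abelian Varieties* (1970), §13 (pp. 125–130) (the Grothendieck complex of the Poincaré bundle over
  the regular local ring `𝒪_{Â,0}`).
-/

universe v u

open CategoryTheory
open scoped Pointwise

namespace Literature.Algebra.Homology

variable {R : Type u} [CommRing R]

section Def

variable (r : R) (K : CochainComplex (ModuleCat.{v} R) ℤ)

/-- **The reduction `K• / r K•` of a cochain complex of `R`-modules modulo an element `r ∈ R`**: termwise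
`(K/rK)ⁱ := Kⁱ / r Kⁱ` (Mathlib `QuotSMulTop r Kⁱ`), differential induced by `d` (`QuotSMulTop.map`).  This is the complex
`K• ⊗_R R/(r)`, written with Mathlib's `QuotSMulTop` so that regular sequences peel off by `isWeaklyRegular_cons_iff`.
[cite: PeskineSzpiro1973, (1.8) (p. 55)] [cite: BrunsHerzog1998, §1.1 (p. 4)] -/
noncomputable def modSMulComplex : CochainComplex (ModuleCat.{v} R) ℤ where
  X i := ModuleCat.of R (QuotSMulTop r (K.X i))
  d i j := ModuleCat.ofHom (QuotSMulTop.map r (K.d i j).hom)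
  shape i j hij := by
    rw [K.shape i j hij]
    simp
  d_comp_d' i j l _ _ := by
    rw [← ModuleCat.ofHom_comp, ← QuotSMulTop.map_comp, ← ModuleCat.hom_comp, K.d_comp_d]
    simp

/-- The terms of `K/rK`. [cite: PeskineSzpiro1973, Lemme (1.8)] [cite: BrunsHerzog1998, §1.1 (p. 4)] -/
theorem modSMulComplex_X (i : ℤ) : (modSMulComplex r K).X i = ModuleCat.of R (QuotSMulTop r (K.X i)) := rfl

/-- The differential of `K/rK` on classes: `d̄ [x] = [d x]`. [cite: PeskineSzpiro1973, Lemme (1.8)] [cite: BrunsHerzog1998, §1.1 (p. 4)] -/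
@[simp]
theorem modSMulComplex_d_mk (i j : ℤ) (x : K.X i) :
    ((modSMulComplex r K).d i j).hom (Submodule.Quotient.mk x) = Submodule.Quotient.mk ((K.d i j).hom x) := rfl

/-- The differential of `K/rK` is `QuotSMulTop.map r d`. [cite: PeskineSzpiro1973, Lemme (1.8)] [cite: BrunsHerzog1998, §1.1 (p. 4)] -/
theorem modSMulComplex_d_hom (i j : ℤ) :
    ((modSMulComplex r K).d i j).hom = QuotSMulTop.map r (K.d i j).hom := rfl

end Def

section Pi

variable (r : R) (K : CochainComplex (ModuleCat.{v} R) ℤ)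

/-- **The quotient morphism `K• ⟶ K•/rK•`** (termwise `Submodule.mkQ`). [cite: PeskineSzpiro1973, Lemme (1.8)]
[cite: BrunsHerzog1998, §1.1 (p. 4)] -/
noncomputable def modSMulComplexπ : K ⟶ modSMulComplex r K where
  f i := ModuleCat.ofHom (r • (⊤ : Submodule R (K.X i))).mkQ
  comm' i j _ := by
    ext x
    rfl

/-- The quotient morphism on elements: `π x = [x]`. [cite: PeskineSzpiro1973, Lemme (1.8)] [cite: BrunsHerzog1998, §1.1 (p. 4)] -/
@[simp]
theorem modSMulComplexπ_f_apply (i : ℤ) (x : K.X i) :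
    ((modSMulComplexπ r K).f i).hom x = Submodule.Quotient.mk x := rfl

/-- The quotient morphism is termwise surjective (`0 → rKⁱ → Kⁱ → Kⁱ/rKⁱ → 0`). [cite: PeskineSzpiro1973, Lemme (1.8)] [cite: BrunsHerzog1998, §1.1 (p. 4)] -/
theorem modSMulComplexπ_f_surjective (i : ℤ) : Function.Surjective ((modSMulComplexπ r K).f i).hom :=
  Submodule.mkQ_surjective _

/-- The kernel of `πⁱ : Kⁱ → Kⁱ/rKⁱ` is `r Kⁱ` (`0 → rKⁱ → Kⁱ → Kⁱ/rKⁱ → 0`). [cite: PeskineSzpiro1973, Lemme (1.8)] [cite: BrunsHerzog1998, §1.1 (p. 4)] -/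
theorem ker_modSMulComplexπ_f (i : ℤ) : LinearMap.ker ((modSMulComplexπ r K).f i).hom = r • (⊤ : Submodule R (K.X i)) :=
  Submodule.ker_mkQ _

end Pi

end Literature.Algebra.Homology
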